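import Mathlib
import Summits.PneNP.PneNP.Theorems.ConvexRankGatesConvexGateBlindExactLiftingTriangleDegreeTwo

/-!
# PneNP / ConvexRankGates — `ConvexGateBlind`, line `xor-door-perfect-completeness`:
# asymptotic DEGREE-2 BLINDNESS of the triangle instance, table side I: bit flips and the moment
# identity of a degree-2 row function (lead c5)

Registered sub-goal `degreeTwo_moment_identity` of crux item stmt-PneNP-10680 (line
`xor-door-perfect-completeness`, open stub `stub_exactLifting : XorDoor.ExactLifting`).

Companion of `…ExactLiftingTriangleDegreeTwo.lean` (pointer side, `anova2_pairing_bound`) and of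
`…ExactLiftingTriangleDegreeTwoBlind.lean` (line conditions and the corollary).  A DEGREE-2 ROW FUNCTION
on the tables `x : Fin 3 → Fin t → 𝔽₂` is
`a(x) = α + Σ_{π,ρ} (A⁰¹(π,ρ)s₀π s₁ρ + A¹²(π,ρ)s₁π s₂ρ + A⁰²(π,ρ)s₀π s₂ρ)` with `s_iπ(x) = (−1)^{x_i(π)}`
(cross-block Fourier degree `≤ 2`: the row functions whose pseudo-expectations only see pair correlations
across blocks; the class contains the junta terms `[x_i(π) = x_j(ρ)]` and the columns
`M_t(·,w) − 1 = 2[x mono at w]` and is strictly richer than the junta cone).  This file provides the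
table-side toolkit, by bit-flip involutions only (no Fourier analysis is imported):

* `flipAt`, `sum_eq_zero_of_flip` — a function that changes sign under flipping one bit sums to zero;
  `sum_sg_pair`, `sum_quad`, `sum_quad_mul_01/12/02` — orthogonality of cross pairs and of products of
  two cross pairs (flip a bit occurring once);
* `sum_a_mono` / `degreeTwo_moment_identity` (registered): the MOMENT IDENTITY
  `4·Σ_x a(x)[x mono at (π,ρ,σ)] = #tables · (α + A⁰¹(π,ρ) + A¹²(ρ,σ) + A⁰²(π,σ))`
  (`[mono] = (1 + s₀π s₁ρ + s₁ρ s₂σ + s₀π s₂σ)/4`), which turns the `(a ⊗ b)`-weighted count of mono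
  entries into the pointer-side pairing `Σ_w b(w)(α + F(w))` bounded in `…TriangleDegreeTwo.lean`.

File-local definitions: `sg` (the sign of a bit), `quad` (the quadratic part), `monoInd`, `flipAt`,
`flipEquiv`.
-/

set_option linter.dupNamespace false -- `Summit.PneNP.PneNP.…`: summit = sub-problem (D-0017)

namespace Summit.PneNP.PneNP.Theorems.XorDoor

open scoped BigOperators
open Finset TriangleInst

noncomputable section

namespace TriDegTwo

variable {t : ℕ}

/-! ## §1 Signs, the quadratic form, bit flips -/

/-- The sign `(−1)^{x_i(π)}` of the bit of table `x` at position `(i, π)`. -/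
def sg (x : Fin 3 → Fin t → ZMod 2) (i : Fin 3) (π : Fin t) : ℝ := sgnR (x i π)

/-- The cross-block quadratic form with coefficient matrices `A⁰¹, A¹², A⁰²`. -/
def quad (A01 A12 A02 : Fin t → Fin t → ℝ) (x : Fin 3 → Fin t → ZMod 2) : ℝ :=
  ∑ π, ∑ ρ, (A01 π ρ * sg x 0 π * sg x 1 ρ + A12 π ρ * sg x 1 π * sg x 2 ρ + A02 π ρ * sg x 0 π * sg x 2 ρ)

/-- The indicator of `x` being mono at the pointer triple `(π, ρ, σ)`. -/
def monoInd (x : Fin 3 → Fin t → ZMod 2) (w : Fin t × Fin t × Fin t) : ℝ :=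
  if x 0 w.1 = x 1 w.2.1 ∧ x 1 w.2.1 = x 2 w.2.2 then 1 else 0

/-- `s(0) = 1`. -/
theorem sgnR_zero : sgnR 0 = 1 := by simp [sgnR]

/-- `s(1) = −1`. -/
theorem sgnR_one : sgnR 1 = -1 := by simp [sgnR]

/-- Flipping a bit flips its sign. -/
theorem sgnR_add_one (b : ZMod 2) : sgnR (b + 1) = - sgnR b := by
  rcases IndexRect.zmod2_cases b with h | h <;> subst h
  · simp [sgnR]
  · have h2 : (1 : ZMod 2) + 1 = 0 := by decide
    simp [sgnR, h2]

/-- Signs square to one. -/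
theorem sgnR_mul_self (b : ZMod 2) : sgnR b * sgnR b = 1 := by
  rcases IndexRect.zmod2_cases b with h | h <;> subst h <;> simp [sgnR]

/-- Signs of table bits square to one. -/
theorem sg_mul_self (x : Fin 3 → Fin t → ZMod 2) (i : Fin 3) (π : Fin t) : sg x i π * sg x i π = 1 :=
  sgnR_mul_self _

/-- Flip the bit at position `(i, π)`. -/
def flipAt (i : Fin 3) (π : Fin t) (x : Fin 3 → Fin t → ZMod 2) : Fin 3 → Fin t → ZMod 2 :=
  fun j ρ => if j = i ∧ ρ = π then x j ρ + 1 else x j ρ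

/-- Flipping twice is the identity. -/
theorem flipAt_flipAt (i : Fin 3) (π : Fin t) (x : Fin 3 → Fin t → ZMod 2) :
    flipAt i π (flipAt i π x) = x := by
  funext j ρ
  by_cases h : j = i ∧ ρ = π
  · simp only [flipAt, h, and_self, if_true]
    rw [add_assoc, show (1 : ZMod 2) + 1 = 0 from by decide, add_zero]
  · simp only [flipAt, h, if_false]

/-- The bit flip as an involutive equivalence of the table space. -/
def flipEquiv (i : Fin 3) (π : Fin t) : (Fin 3 → Fin t → ZMod 2) ≃ (Fin 3 → Fin t → ZMod 2) where
  toFun := flipAt i π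
  invFun := flipAt i π
  left_inv := flipAt_flipAt i π
  right_inv := flipAt_flipAt i π

/-- The flipped position changes sign. -/
theorem sg_flip_same (i : Fin 3) (π : Fin t) (x : Fin 3 → Fin t → ZMod 2) :
    sg (flipAt i π x) i π = - sg x i π := by
  simp [sg, flipAt, sgnR_add_one]

/-- Positions in another block keep their sign. -/
theorem sg_flip_of_ne {i j : Fin 3} (hij : j ≠ i) (π ρ : Fin t) (x : Fin 3 → Fin t → ZMod 2) :
    sg (flipAt i π x) j ρ = sg x j ρ := by
  simp only [sg, flipAt, hij, false_and, if_false]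

/-- Other positions of the same block keep their sign. -/
theorem sg_flip_of_ne' (i : Fin 3) {π ρ : Fin t} (hρ : ρ ≠ π) (x : Fin 3 → Fin t → ZMod 2) :
    sg (flipAt i π x) i ρ = sg x i ρ := by
  simp only [sg, flipAt, hρ, and_false, if_false]

/-- A function that changes sign under a bit flip sums to zero. -/
theorem sum_eq_zero_of_flip (i : Fin 3) (π : Fin t) (f : (Fin 3 → Fin t → ZMod 2) → ℝ)
    (hf : ∀ x, f (flipAt i π x) = - f x) : ∑ x, f x = 0 := by
  have h : ∑ x, f x = ∑ x, f (flipAt i π x) := (Equiv.sum_comp (flipEquiv i π) f).symm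
  have h2 : ∑ x, f (flipAt i π x) = - ∑ x, f x := by
    rw [← Finset.sum_neg_distrib]; exact Finset.sum_congr rfl fun x _ => hf x
  linarith

/-! ## §2 Orthogonality: cross pairs and products of two cross pairs -/

/-- A single cross pair sums to zero. -/
theorem sum_sg_pair {i j : Fin 3} (hij : i ≠ j) (π ρ : Fin t) :
    ∑ x : Fin 3 → Fin t → ZMod 2, sg x i π * sg x j ρ = 0 := by
  refine sum_eq_zero_of_flip i π _ fun x => ?_
  rw [sg_flip_same, sg_flip_of_ne hij.symm]; ring

/-- The number of tables, as a real. -/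
theorem sum_one_tables : ∑ _x : Fin 3 → Fin t → ZMod 2, (1 : ℝ) = (Fintype.card (Fin 3 → Fin t → ZMod 2) : ℝ) := by
  simp

/-- `Σ_x quad(x) = 0`. -/
theorem sum_quad (A01 A12 A02 : Fin t → Fin t → ℝ) :
    ∑ x : Fin 3 → Fin t → ZMod 2, quad A01 A12 A02 x = 0 := by
  simp only [quad]
  rw [Finset.sum_comm]
  refine Finset.sum_eq_zero fun π _ => ?_
  rw [Finset.sum_comm]
  refine Finset.sum_eq_zero fun ρ _ => ?_
  simp only [Finset.sum_add_distrib, mul_assoc, ← Finset.mul_sum]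
  rw [sum_sg_pair (by decide : (0 : Fin 3) ≠ 1), sum_sg_pair (by decide : (1 : Fin 3) ≠ 2),
    sum_sg_pair (by decide : (0 : Fin 3) ≠ 2)]
  ring

/-- `Σ_x quad(x)·s₀π s₁ρ = #tables · A⁰¹(π,ρ)`. -/
theorem sum_quad_mul_01 (A01 A12 A02 : Fin t → Fin t → ℝ) (π ρ : Fin t) :
    ∑ x : Fin 3 → Fin t → ZMod 2, quad A01 A12 A02 x * (sg x 0 π * sg x 1 ρ) =
      (Fintype.card (Fin 3 → Fin t → ZMod 2) : ℝ) * A01 π ρ := by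
  have h12 : ∀ π' ρ', ∑ x : Fin 3 → Fin t → ZMod 2, sg x 1 π' * sg x 2 ρ' * (sg x 0 π * sg x 1 ρ) = 0 := by
    intro π' ρ'
    refine sum_eq_zero_of_flip 0 π _ fun x => ?_
    rw [sg_flip_same, sg_flip_of_ne (by decide : (1 : Fin 3) ≠ 0), sg_flip_of_ne (by decide : (2 : Fin 3) ≠ 0),
      sg_flip_of_ne (by decide : (1 : Fin 3) ≠ 0)]; ring
  have h02 : ∀ π' ρ', ∑ x : Fin 3 → Fin t → ZMod 2, sg x 0 π' * sg x 2 ρ' * (sg x 0 π * sg x 1 ρ) = 0 := by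
    intro π' ρ'
    refine sum_eq_zero_of_flip 1 ρ _ fun x => ?_
    rw [sg_flip_same, sg_flip_of_ne (by decide : (0 : Fin 3) ≠ 1), sg_flip_of_ne (by decide : (2 : Fin 3) ≠ 1),
      sg_flip_of_ne (by decide : (0 : Fin 3) ≠ 1)]; ring
  have h01 : ∀ π' ρ', ∑ x : Fin 3 → Fin t → ZMod 2, sg x 0 π' * sg x 1 ρ' * (sg x 0 π * sg x 1 ρ) =
      if π' = π ∧ ρ' = ρ then (Fintype.card (Fin 3 → Fin t → ZMod 2) : ℝ) else 0 := by
    intro π' ρ'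
    by_cases hπ : π' = π
    · by_cases hρ : ρ' = ρ
      · subst hπ; subst hρ
        simp only [and_self, if_true]
        rw [← sum_one_tables]
        refine Finset.sum_congr rfl fun x _ => ?_
        have h0 := sg_mul_self x 0 π'; have h1 := sg_mul_self x 1 ρ'
        linear_combination (sg x 1 ρ' * sg x 1 ρ') * h0 + h1
      · rw [if_neg (fun h => hρ h.2)]
        refine sum_eq_zero_of_flip 1 ρ _ fun x => ?_
        rw [sg_flip_same, sg_flip_of_ne (by decide : (0 : Fin 3) ≠ 1), sg_flip_of_ne (by decide : (0 : Fin 3) ≠ 1),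
          sg_flip_of_ne' 1 hρ]; ring
    · rw [if_neg (fun h => hπ h.1)]
      refine sum_eq_zero_of_flip 0 π _ fun x => ?_
      rw [sg_flip_same, sg_flip_of_ne (by decide : (1 : Fin 3) ≠ 0), sg_flip_of_ne (by decide : (1 : Fin 3) ≠ 0),
        sg_flip_of_ne' 0 hπ]; ring
  -- expand
  simp only [quad, Finset.sum_mul]
  rw [Finset.sum_comm]
  have : ∀ π', (∑ x : Fin 3 → Fin t → ZMod 2, ∑ ρ',
      (A01 π' ρ' * sg x 0 π' * sg x 1 ρ' + A12 π' ρ' * sg x 1 π' * sg x 2 ρ' + A02 π' ρ' * sg x 0 π' * sg x 2 ρ') *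
        (sg x 0 π * sg x 1 ρ)) = ∑ ρ', A01 π' ρ' * (if π' = π ∧ ρ' = ρ then (Fintype.card (Fin 3 → Fin t → ZMod 2) : ℝ) else 0) := by
    intro π'
    rw [Finset.sum_comm]
    refine Finset.sum_congr rfl fun ρ' _ => ?_
    have hsplit : ∀ x : Fin 3 → Fin t → ZMod 2,
        (A01 π' ρ' * sg x 0 π' * sg x 1 ρ' + A12 π' ρ' * sg x 1 π' * sg x 2 ρ' + A02 π' ρ' * sg x 0 π' * sg x 2 ρ') *
          (sg x 0 π * sg x 1 ρ) =
        A01 π' ρ' * (sg x 0 π' * sg x 1 ρ' * (sg x 0 π * sg x 1 ρ)) +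
        A12 π' ρ' * (sg x 1 π' * sg x 2 ρ' * (sg x 0 π * sg x 1 ρ)) +
        A02 π' ρ' * (sg x 0 π' * sg x 2 ρ' * (sg x 0 π * sg x 1 ρ)) := fun x => by ring
    simp only [hsplit, Finset.sum_add_distrib, ← Finset.mul_sum, h01, h12, h02, mul_zero, add_zero]
  simp only [this]
  rw [Finset.sum_eq_single π]
  · rw [Finset.sum_eq_single ρ]
    · simp only [and_self, if_true]
      ring
    · intro ρ' _ hρ'; rw [if_neg (fun h => hρ' h.2), mul_zero]
    · intro h; exact absurd (Finset.mem_univ ρ) h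
  · intro π' _ hπ'
    refine Finset.sum_eq_zero fun ρ' _ => ?_
    rw [if_neg (fun h => hπ' h.1), mul_zero]
  · intro h; exact absurd (Finset.mem_univ π) h

/-- `Σ_x quad(x)·s₁ρ s₂σ = #tables · A¹²(ρ,σ)`. -/
theorem sum_quad_mul_12 (A01 A12 A02 : Fin t → Fin t → ℝ) (ρ σ : Fin t) :
    ∑ x : Fin 3 → Fin t → ZMod 2, quad A01 A12 A02 x * (sg x 1 ρ * sg x 2 σ) =
      (Fintype.card (Fin 3 → Fin t → ZMod 2) : ℝ) * A12 ρ σ := by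
  have h01 : ∀ π' ρ', ∑ x : Fin 3 → Fin t → ZMod 2, sg x 0 π' * sg x 1 ρ' * (sg x 1 ρ * sg x 2 σ) = 0 := by
    intro π' ρ'
    refine sum_eq_zero_of_flip 2 σ _ fun x => ?_
    rw [sg_flip_same, sg_flip_of_ne (by decide : (0 : Fin 3) ≠ 2), sg_flip_of_ne (by decide : (1 : Fin 3) ≠ 2),
      sg_flip_of_ne (by decide : (1 : Fin 3) ≠ 2)]; ring
  have h02 : ∀ π' ρ', ∑ x : Fin 3 → Fin t → ZMod 2, sg x 0 π' * sg x 2 ρ' * (sg x 1 ρ * sg x 2 σ) = 0 := by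
    intro π' ρ'
    refine sum_eq_zero_of_flip 1 ρ _ fun x => ?_
    rw [sg_flip_same, sg_flip_of_ne (by decide : (0 : Fin 3) ≠ 1), sg_flip_of_ne (by decide : (2 : Fin 3) ≠ 1),
      sg_flip_of_ne (by decide : (2 : Fin 3) ≠ 1)]; ring
  have h12 : ∀ π' ρ', ∑ x : Fin 3 → Fin t → ZMod 2, sg x 1 π' * sg x 2 ρ' * (sg x 1 ρ * sg x 2 σ) =
      if π' = ρ ∧ ρ' = σ then (Fintype.card (Fin 3 → Fin t → ZMod 2) : ℝ) else 0 := by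
    intro π' ρ'
    by_cases hπ : π' = ρ
    · by_cases hρ : ρ' = σ
      · subst hπ; subst hρ
        simp only [and_self, if_true]
        rw [← sum_one_tables]
        refine Finset.sum_congr rfl fun x _ => ?_
        have h0 := sg_mul_self x 1 π'; have h1 := sg_mul_self x 2 ρ'
        linear_combination (sg x 2 ρ' * sg x 2 ρ') * h0 + h1
      · rw [if_neg (fun h => hρ h.2)]
        refine sum_eq_zero_of_flip 2 σ _ fun x => ?_
        rw [sg_flip_same, sg_flip_of_ne (by decide : (1 : Fin 3) ≠ 2), sg_flip_of_ne (by decide : (1 : Fin 3) ≠ 2),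
          sg_flip_of_ne' 2 hρ]; ring
    · rw [if_neg (fun h => hπ h.1)]
      refine sum_eq_zero_of_flip 1 ρ _ fun x => ?_
      rw [sg_flip_same, sg_flip_of_ne (by decide : (2 : Fin 3) ≠ 1), sg_flip_of_ne (by decide : (2 : Fin 3) ≠ 1),
        sg_flip_of_ne' 1 hπ]; ring
  simp only [quad, Finset.sum_mul]
  rw [Finset.sum_comm]
  have : ∀ π', (∑ x : Fin 3 → Fin t → ZMod 2, ∑ ρ',
      (A01 π' ρ' * sg x 0 π' * sg x 1 ρ' + A12 π' ρ' * sg x 1 π' * sg x 2 ρ' + A02 π' ρ' * sg x 0 π' * sg x 2 ρ') *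
        (sg x 1 ρ * sg x 2 σ)) = ∑ ρ', A12 π' ρ' * (if π' = ρ ∧ ρ' = σ then (Fintype.card (Fin 3 → Fin t → ZMod 2) : ℝ) else 0) := by
    intro π'
    rw [Finset.sum_comm]
    refine Finset.sum_congr rfl fun ρ' _ => ?_
    have hsplit : ∀ x : Fin 3 → Fin t → ZMod 2,
        (A01 π' ρ' * sg x 0 π' * sg x 1 ρ' + A12 π' ρ' * sg x 1 π' * sg x 2 ρ' + A02 π' ρ' * sg x 0 π' * sg x 2 ρ') *
          (sg x 1 ρ * sg x 2 σ) =
        A01 π' ρ' * (sg x 0 π' * sg x 1 ρ' * (sg x 1 ρ * sg x 2 σ)) +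
        A12 π' ρ' * (sg x 1 π' * sg x 2 ρ' * (sg x 1 ρ * sg x 2 σ)) +
        A02 π' ρ' * (sg x 0 π' * sg x 2 ρ' * (sg x 1 ρ * sg x 2 σ)) := fun x => by ring
    simp only [hsplit, Finset.sum_add_distrib, ← Finset.mul_sum, h01, h12, h02, mul_zero, add_zero, zero_add]
  simp only [this]
  rw [Finset.sum_eq_single ρ]
  · rw [Finset.sum_eq_single σ]
    · simp only [and_self, if_true]
      ring
    · intro ρ' _ hρ'; rw [if_neg (fun h => hρ' h.2), mul_zero]
    · intro h; exact absurd (Finset.mem_univ σ) h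
  · intro π' _ hπ'
    refine Finset.sum_eq_zero fun ρ' _ => ?_
    rw [if_neg (fun h => hπ' h.1), mul_zero]
  · intro h; exact absurd (Finset.mem_univ ρ) h

/-- `Σ_x quad(x)·s₀π s₂σ = #tables · A⁰²(π,σ)`. -/
theorem sum_quad_mul_02 (A01 A12 A02 : Fin t → Fin t → ℝ) (π σ : Fin t) :
    ∑ x : Fin 3 → Fin t → ZMod 2, quad A01 A12 A02 x * (sg x 0 π * sg x 2 σ) =
      (Fintype.card (Fin 3 → Fin t → ZMod 2) : ℝ) * A02 π σ := by
  have h01 : ∀ π' ρ', ∑ x : Fin 3 → Fin t → ZMod 2, sg x 0 π' * sg x 1 ρ' * (sg x 0 π * sg x 2 σ) = 0 := by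
    intro π' ρ'
    refine sum_eq_zero_of_flip 2 σ _ fun x => ?_
    rw [sg_flip_same, sg_flip_of_ne (by decide : (0 : Fin 3) ≠ 2), sg_flip_of_ne (by decide : (1 : Fin 3) ≠ 2),
      sg_flip_of_ne (by decide : (0 : Fin 3) ≠ 2)]; ring
  have h12 : ∀ π' ρ', ∑ x : Fin 3 → Fin t → ZMod 2, sg x 1 π' * sg x 2 ρ' * (sg x 0 π * sg x 2 σ) = 0 := by
    intro π' ρ'
    refine sum_eq_zero_of_flip 0 π _ fun x => ?_
    rw [sg_flip_same, sg_flip_of_ne (by decide : (1 : Fin 3) ≠ 0), sg_flip_of_ne (by decide : (2 : Fin 3) ≠ 0),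
      sg_flip_of_ne (by decide : (2 : Fin 3) ≠ 0)]; ring
  have h02 : ∀ π' ρ', ∑ x : Fin 3 → Fin t → ZMod 2, sg x 0 π' * sg x 2 ρ' * (sg x 0 π * sg x 2 σ) =
      if π' = π ∧ ρ' = σ then (Fintype.card (Fin 3 → Fin t → ZMod 2) : ℝ) else 0 := by
    intro π' ρ'
    by_cases hπ : π' = π
    · by_cases hρ : ρ' = σ
      · subst hπ; subst hρ
        simp only [and_self, if_true]
        rw [← sum_one_tables]
        refine Finset.sum_congr rfl fun x _ => ?_
        have h0 := sg_mul_self x 0 π'; have h1 := sg_mul_self x 2 ρ'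
        linear_combination (sg x 2 ρ' * sg x 2 ρ') * h0 + h1
      · rw [if_neg (fun h => hρ h.2)]
        refine sum_eq_zero_of_flip 2 σ _ fun x => ?_
        rw [sg_flip_same, sg_flip_of_ne (by decide : (0 : Fin 3) ≠ 2), sg_flip_of_ne (by decide : (0 : Fin 3) ≠ 2),
          sg_flip_of_ne' 2 hρ]; ring
    · rw [if_neg (fun h => hπ h.1)]
      refine sum_eq_zero_of_flip 0 π _ fun x => ?_
      rw [sg_flip_same, sg_flip_of_ne (by decide : (2 : Fin 3) ≠ 0), sg_flip_of_ne (by decide : (2 : Fin 3) ≠ 0),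
        sg_flip_of_ne' 0 hπ]; ring
  simp only [quad, Finset.sum_mul]
  rw [Finset.sum_comm]
  have : ∀ π', (∑ x : Fin 3 → Fin t → ZMod 2, ∑ ρ',
      (A01 π' ρ' * sg x 0 π' * sg x 1 ρ' + A12 π' ρ' * sg x 1 π' * sg x 2 ρ' + A02 π' ρ' * sg x 0 π' * sg x 2 ρ') *
        (sg x 0 π * sg x 2 σ)) = ∑ ρ', A02 π' ρ' * (if π' = π ∧ ρ' = σ then (Fintype.card (Fin 3 → Fin t → ZMod 2) : ℝ) else 0) := by
    intro π'
    rw [Finset.sum_comm]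
    refine Finset.sum_congr rfl fun ρ' _ => ?_
    have hsplit : ∀ x : Fin 3 → Fin t → ZMod 2,
        (A01 π' ρ' * sg x 0 π' * sg x 1 ρ' + A12 π' ρ' * sg x 1 π' * sg x 2 ρ' + A02 π' ρ' * sg x 0 π' * sg x 2 ρ') *
          (sg x 0 π * sg x 2 σ) =
        A01 π' ρ' * (sg x 0 π' * sg x 1 ρ' * (sg x 0 π * sg x 2 σ)) +
        A12 π' ρ' * (sg x 1 π' * sg x 2 ρ' * (sg x 0 π * sg x 2 σ)) +
        A02 π' ρ' * (sg x 0 π' * sg x 2 ρ' * (sg x 0 π * sg x 2 σ)) := fun x => by ring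
    simp only [hsplit, Finset.sum_add_distrib, ← Finset.mul_sum, h01, h12, h02, mul_zero, zero_add]
  simp only [this]
  rw [Finset.sum_eq_single π]
  · rw [Finset.sum_eq_single σ]
    · simp only [and_self, if_true]
      ring
    · intro ρ' _ hρ'; rw [if_neg (fun h => hρ' h.2), mul_zero]
    · intro h; exact absurd (Finset.mem_univ σ) h
  · intro π' _ hπ'
    refine Finset.sum_eq_zero fun ρ' _ => ?_
    rw [if_neg (fun h => hπ' h.1), mul_zero]
  · intro h; exact absurd (Finset.mem_univ π) h

/-! ## §3 The moment identity -/

/-- `[mono] = (1 + s₀π s₁ρ + s₁ρ s₂σ + s₀π s₂σ)/4`. -/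
theorem monoInd_eq (x : Fin 3 → Fin t → ZMod 2) (w : Fin t × Fin t × Fin t) :
    4 * monoInd x w = 1 + sg x 0 w.1 * sg x 1 w.2.1 + sg x 1 w.2.1 * sg x 2 w.2.2 + sg x 0 w.1 * sg x 2 w.2.2 := by
  simp only [monoInd, sg, sgnR]
  rcases IndexRect.zmod2_cases (x 0 w.1) with h0 | h0 <;>
  rcases IndexRect.zmod2_cases (x 1 w.2.1) with h1 | h1 <;>
  rcases IndexRect.zmod2_cases (x 2 w.2.2) with h2 | h2 <;>
  simp [h0, h1, h2] <;> norm_num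

/-- **Moment identity.** For a degree-2 row function `a = α + quad`:
`4·Σ_x a(x)[x mono at (π,ρ,σ)] = #tables·(α + A⁰¹(π,ρ) + A¹²(ρ,σ) + A⁰²(π,σ))`. -/
theorem sum_a_mono (α : ℝ) (A01 A12 A02 : Fin t → Fin t → ℝ) (a : (Fin 3 → Fin t → ZMod 2) → ℝ)
    (ha : ∀ x, a x = α + quad A01 A12 A02 x) (w : Fin t × Fin t × Fin t) :
    4 * ∑ x, a x * monoInd x w =
      (Fintype.card (Fin 3 → Fin t → ZMod 2) : ℝ) * (α + Fpair A01 A12 A02 w) := by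
  have hx : ∀ x, 4 * (a x * monoInd x w) = a x * 1 + a x * (sg x 0 w.1 * sg x 1 w.2.1)
      + a x * (sg x 1 w.2.1 * sg x 2 w.2.2) + a x * (sg x 0 w.1 * sg x 2 w.2.2) := by
    intro x
    have := monoInd_eq x w
    linear_combination a x * this
  rw [Finset.mul_sum]
  simp only [hx, Finset.sum_add_distrib]
  -- the four sums
  have hS0 : ∑ x, a x * 1 = (Fintype.card (Fin 3 → Fin t → ZMod 2) : ℝ) * α := by
    simp only [mul_one, ha, Finset.sum_add_distrib, sum_quad, add_zero, Finset.sum_const, Finset.card_univ,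
      nsmul_eq_mul]
  have hS1 : ∑ x, a x * (sg x 0 w.1 * sg x 1 w.2.1) = (Fintype.card (Fin 3 → Fin t → ZMod 2) : ℝ) * A01 w.1 w.2.1 := by
    simp only [ha, add_mul, Finset.sum_add_distrib, sum_quad_mul_01, ← Finset.mul_sum,
      sum_sg_pair (by decide : (0 : Fin 3) ≠ 1), mul_zero, zero_add]
  have hS2 : ∑ x, a x * (sg x 1 w.2.1 * sg x 2 w.2.2) = (Fintype.card (Fin 3 → Fin t → ZMod 2) : ℝ) * A12 w.2.1 w.2.2 := by
    simp only [ha, add_mul, Finset.sum_add_distrib, sum_quad_mul_12, ← Finset.mul_sum,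
      sum_sg_pair (by decide : (1 : Fin 3) ≠ 2), mul_zero, zero_add]
  have hS3 : ∑ x, a x * (sg x 0 w.1 * sg x 2 w.2.2) = (Fintype.card (Fin 3 → Fin t → ZMod 2) : ℝ) * A02 w.1 w.2.2 := by
    simp only [ha, add_mul, Finset.sum_add_distrib, sum_quad_mul_02, ← Finset.mul_sum,
      sum_sg_pair (by decide : (0 : Fin 3) ≠ 2), mul_zero, zero_add]
  rw [hS0, hS1, hS2, hS3]
  simp only [Fpair]
  ring

end TriDegTwo

/-- **Registered sub-goal `degreeTwo_moment_identity` of stmt-PneNP-10680** (by name): for a degree-2 row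
function `a = α + quad A⁰¹ A¹² A⁰²` on the tables and every pointer triple `w = (π,ρ,σ)`,
`4·Σ_x a(x)[x mono at w] = #tables · (α + A⁰¹(π,ρ) + A¹²(ρ,σ) + A⁰²(π,σ))`. -/
theorem degreeTwo_moment_identity : ∀ (t : ℕ) (α : ℝ) (A01 A12 A02 : Fin t → Fin t → ℝ)
    (a : (Fin 3 → Fin t → ZMod 2) → ℝ), (∀ x, a x = α + TriDegTwo.quad A01 A12 A02 x) →
    ∀ w : Fin t × Fin t × Fin t,
      4 * ∑ x, a x * TriDegTwo.monoInd x w =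
        (Fintype.card (Fin 3 → Fin t → ZMod 2) : ℝ) * (α + (A01 w.1 w.2.1 + A12 w.2.1 w.2.2 + A02 w.1 w.2.2)) :=
  fun _ α A01 A12 A02 a ha w => TriDegTwo.sum_a_mono α A01 A12 A02 a ha w

end

end Summit.PneNP.PneNP.Theorems.XorDoor
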